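import Literature.NumberTheory.Automorphic.IsomorphismGraphKernel
import Literature.NumberTheory.Automorphic.ReductiveDualProofs
import Literature.NumberTheory.Automorphic.RootDataReducedHolds
import Literature.NumberTheory.Automorphic.RootSubgroupUnique
import Literature.NumberTheory.Automorphic.ReductiveDualLGroupProofs
import HarnessLib

/-!
# The isomorphism theorem, abstract form (Springer 9.6.2, step 1): discharge of
# `chevalley_isomorphism_abstract`

Springer, *Linear Algebraic Groups* (2nd ed.), Theorem 9.6.2: two connected reductive groups over
an algebraically closed field whose root data (relative to maximal tori `T`, `T'`) are isomorphic
are isomorphic, by an isomorphism mapping `T` onto `T'` and inducing the given isomorphism of root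
data. The named fact `chevalley_isomorphism_abstract` (`ReductiveDualProofs.lean`) is the first
step of the printed proof in characteristic `0`: the existence of an isomorphism of *abstract*
groups `f : G ≃* G'` inducing the identity of the common root datum `P` (`InducesRootDatumId`).

Springer obtains `f` from the presentation of `G` by generators and relations (9.4.3) once the
structure constants have been normalised (9.2–9.5). This file discharges the fact by the **graph
method** (Chevalley, Séminaire 1956–58, exp. 24; Humphreys, *Linear Algebraic Groups* §33;
Steinberg, *Lectures on Chevalley groups* §10), carried out on the Lie algebra in characteristic
`0` in the files `IsomorphismGraphGroup`, `IsomorphismGraphLieGens`, `IsomorphismGraphLieTriangular`,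
`IsomorphismGraphLieRoots`, `WeightClassCharacters`, `IsomorphismGraphCentral`,
`IsomorphismGraphKernel`: inside `G × G' ≤ GL_{N+N'}` let `H` be the subgroup generated by the graph
`T̃` of the isomorphism of tori `f_T : T ≃ T'` defined by `X*(T) ≅ X ≅ X*(T')` and by the diagonal
root homomorphisms `x ↦ (u_{±α}(x), u'_{±α}(x))` of the simple roots `α` of a base of `P`. Then

* `H` is a connected algebraic subgroup whose two projections contain `T`, `U_{±α}` (resp. `T'`,
  `U'_{±α}`), hence are onto (`G` is generated by `T` and the `U_{±α}`, `α` simple: Springer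
  8.1.1 (ii) with 8.2.10, `IsRootDatumOf.torus_sup_rootSubgroups_eq_of_charZero`,
  `IsRootDatumOf.torus_sup_rootSubgroups_base_eq_of_sup_eq`, and 8.1.1 (i)
  `rootSubgroup_unique_holds` to identify `U_{±α}` with the images of the chosen root
  homomorphisms);
* both projections are injective on `H` (`eq_one_of_inr_mem_graphGroup`,
  `eq_one_of_inl_mem_graphGroup`: the Lie algebra of `H` is a graph, `Z_H(T̃) = T̃`, and the
  determinant characters of the two representations exclude a central torus in the kernels);
* so `H` is the graph of an isomorphism `f = pr₂ ∘ (pr₁|_H)⁻¹ : G ≃* G'`, which restricts to `f_T`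
  on `T` (so `χ'_x ∘ f = χ_x`), maps `T` onto `T'`, and carries the root homomorphism `u_α` of
  every root `α` to the root homomorphism `x ↦ u'_α(c_α x)` (`c_α ≠ 0`) read off from the root line
  `Lie(H)_α = k · (e_α, c_α e'_α)` (`isRootLine_root`), i.e. `InducesRootDatumId h h' f`.

* **`chevalley_isomorphism_abstract_holds`** — the discharge `theorem … : chevalley_isomorphism_abstract`.

Everything is proved; no named fact is introduced and none is assumed.

## References

* [SpringerLAG1998] T. A. Springer, *Linear Algebraic Groups*, 2nd ed., Progress in Mathematics 9,
  Birkhäuser (1998), 8.1.1, 8.2.10, Theorem 9.6.2.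
* [Humphreys1975] J. E. Humphreys, *Linear Algebraic Groups*, GTM 21 (1975), §32.1, §33.
* R. Steinberg, *Lectures on Chevalley groups*, Yale (1968), §10.
* C. Chevalley, *Classification des groupes de Lie algébriques*, Séminaire ENS 1956–58, exp. 24.
-/

noncomputable section

open scoped MatrixGroups IsMulCommutative
open Matrix

namespace Literature.NumberTheory.Automorphic

/-! ### The graph group is the graph of an isomorphism -/

section GraphIso

variable {k : Type*} [Field k] {n n' : Type*} [Fintype n] [DecidableEq n] [Fintype n'] [DecidableEq n']
variable {ι X Y : Type*} [AddCommGroup X] [AddCommGroup Y]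
variable {G T : Subgroup (GL n k)} {G' T' : Subgroup (GL n' k)}
variable [IsMulCommutative ↥T] [IsMulCommutative ↥T']
variable {P : RootPairing ι ℤ X Y}
variable {eX : Additive ↥(characterLattice T) ≃+ X} {eY : Additive ↥(cocharacterLattice T) ≃+ Y}
variable {eX' : Additive ↥(characterLattice T') ≃+ X} {eY' : Additive ↥(cocharacterLattice T') ≃+ Y}

variable [IsAlgClosed k] [CharZero k] (h : IsRootDatumOf G T P eX eY) (h' : IsRootDatumOf G' T' P eX' eY')
  (b : P.Base) (hG : IsConnectedReductive G) (hTm : IsMaximalTorusIn T G)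
  (hG' : IsConnectedReductive G') (hTm' : IsMaximalTorusIn T' G')

/-- The first projection `H → G` of the graph group. [folklore] -/
def graphFst : ↥(graphGroup h h' hTm.2.1 hTm'.2.1 (b.support : Set ι)) →* ↥G :=
  ((fstBlockGL (n := n) (n' := n') (k := k)).comp
    (Subgroup.inclusion (graphGroup_le_blockDiagRange h h' hTm.2.1 hTm'.2.1 (b.support : Set ι)))).codRestrict G
    (fun x => by
      obtain ⟨g, hg, g', hg', hx⟩ := mem_prodBlock_iff.1 (graphGroup_le_prodBlock h h' hTm.2.1 hTm'.2.1 _ x.2)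
      rw [MonoidHom.comp_apply, show Subgroup.inclusion (graphGroup_le_blockDiagRange h h' hTm.2.1 hTm'.2.1 _) x =
        ⟨blockDiagGL (g, g'), blockDiagGL_mem_blockDiagRange _⟩ from Subtype.ext hx.symm, fstBlockGL_mk]
      exact hg)

/-- The second projection `H → G'` of the graph group. [folklore] -/
def graphSnd : ↥(graphGroup h h' hTm.2.1 hTm'.2.1 (b.support : Set ι)) →* ↥G' :=
  ((sndBlockGL (n := n) (n' := n') (k := k)).comp
    (Subgroup.inclusion (graphGroup_le_blockDiagRange h h' hTm.2.1 hTm'.2.1 (b.support : Set ι)))).codRestrict G'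
    (fun x => by
      obtain ⟨g, hg, g', hg', hx⟩ := mem_prodBlock_iff.1 (graphGroup_le_prodBlock h h' hTm.2.1 hTm'.2.1 _ x.2)
      rw [MonoidHom.comp_apply, show Subgroup.inclusion (graphGroup_le_blockDiagRange h h' hTm.2.1 hTm'.2.1 _) x =
        ⟨blockDiagGL (g, g'), blockDiagGL_mem_blockDiagRange _⟩ from Subtype.ext hx.symm, sndBlockGL_mk]
      exact hg')

omit [CharZero k] in
/-- The two projections recover the element: `x = diag(pr₁ x, pr₂ x)`. [folklore] -/
lemma blockDiagGL_graphFst_graphSnd (x : ↥(graphGroup h h' hTm.2.1 hTm'.2.1 (b.support : Set ι))) :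
    blockDiagGL (((graphFst h h' b hTm hTm' x : ↥G) : GL n k), ((graphSnd h h' b hTm hTm' x : ↥G') : GL n' k)) =
      (x : GL (n ⊕ n') k) := by
  change blockDiagGL (fstBlockGL (Subgroup.inclusion (graphGroup_le_blockDiagRange h h' hTm.2.1 hTm'.2.1 _) x),
    sndBlockGL (Subgroup.inclusion (graphGroup_le_blockDiagRange h h' hTm.2.1 hTm'.2.1 _) x)) = _
  rw [blockDiagGL_fstBlockGL_sndBlockGL]
  rfl

omit [CharZero k] in
/-- On an element `diag(g, g') ∈ H` the projections are `g` and `g'`. [folklore] -/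
lemma graphFst_mk {g : GL n k} {g' : GL n' k} (hx : blockDiagGL (g, g') ∈ graphGroup h h' hTm.2.1 hTm'.2.1 (b.support : Set ι)) :
    ((graphFst h h' b hTm hTm' ⟨blockDiagGL (g, g'), hx⟩ : ↥G) : GL n k) = g ∧
      ((graphSnd h h' b hTm hTm' ⟨blockDiagGL (g, g'), hx⟩ : ↥G') : GL n' k) = g' := by
  constructor
  · change fstBlockGL (⟨blockDiagGL (g, g'), _⟩ : ↥(blockDiagRange n n' k)) = g
    rw [fstBlockGL_mk]
  · change sndBlockGL (⟨blockDiagGL (g, g'), _⟩ : ↥(blockDiagRange n n' k)) = g'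
    rw [sndBlockGL_mk]

variable [Finite ι] [P.IsReduced]

include hG hG' in
/-- **The first projection is injective on `H`** (`eq_one_of_inr_mem_graphGroup`). [cite: SpringerLAG1998, 9.6.2] -/
theorem graphFst_injective : Function.Injective (graphFst h h' b hTm hTm') := by
  intro x y hxy
  have ex := blockDiagGL_graphFst_graphSnd h h' b hTm hTm' x
  have ey := blockDiagGL_graphFst_graphSnd h h' b hTm hTm' y
  have hmem : blockDiagGL ((1 : GL n k), ((graphSnd h h' b hTm hTm' x : ↥G') : GL n' k) *
      ((graphSnd h h' b hTm hTm' y : ↥G') : GL n' k)⁻¹) ∈ graphGroup h h' hTm.2.1 hTm'.2.1 (b.support : Set ι) := by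
    have := Subgroup.mul_mem _ x.2 (Subgroup.inv_mem _ y.2)
    rw [← ex, ← ey, ← map_inv, ← map_mul] at this
    convert this using 2
    refine Prod.ext ?_ rfl
    simp [hxy]
  have h1 := eq_one_of_inr_mem_graphGroup h h' b hG hTm hG' hTm' hmem
  apply Subtype.ext
  rw [← ex, ← ey, hxy, mul_inv_eq_one.1 h1]

include hG hG' in
/-- **The second projection is injective on `H`** (`eq_one_of_inl_mem_graphGroup`). [cite: SpringerLAG1998, 9.6.2] -/
theorem graphSnd_injective : Function.Injective (graphSnd h h' b hTm hTm') := by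
  intro x y hxy
  have ex := blockDiagGL_graphFst_graphSnd h h' b hTm hTm' x
  have ey := blockDiagGL_graphFst_graphSnd h h' b hTm hTm' y
  have hmem : blockDiagGL (((graphFst h h' b hTm hTm' x : ↥G) : GL n k) *
      ((graphFst h h' b hTm hTm' y : ↥G) : GL n k)⁻¹, (1 : GL n' k)) ∈ graphGroup h h' hTm.2.1 hTm'.2.1 (b.support : Set ι) := by
    have := Subgroup.mul_mem _ x.2 (Subgroup.inv_mem _ y.2)
    rw [← ex, ← ey, ← map_inv, ← map_mul] at this
    convert this using 2
    refine Prod.ext rfl ?_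
    simp [hxy]
  have h1 := eq_one_of_inl_mem_graphGroup h h' b hG hTm hG' hTm' hmem
  apply Subtype.ext
  rw [← ex, ← ey, hxy, mul_inv_eq_one.1 h1]

include hG hTm in
/-- **`G` is generated by `T` and the chosen root homomorphisms of the simple roots and their
negatives** (Springer 8.1.1 (ii) in characteristic `0`, 8.2.10, and the uniqueness 8.1.1 (i) of root
subgroups). [cite: SpringerLAG1998, 8.1.1 and 8.2.10] -/
theorem torus_sup_ranges_eq_top :
    T ⊔ ⨆ i : ↥(b.support : Set ι), (((h.rootSL2 i).comp unipotentUpperSL2).range.map G.subtype ⊔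
      ((h.rootSL2 i).comp unipotentLowerSL2).range.map G.subtype) = G := by
  have hgen := h.torus_sup_rootSubgroups_base_eq_of_sup_eq b (h.torus_sup_rootSubgroups_eq_of_charZero hG hTm)
  -- identify the root subgroups with the ranges of the chosen root homomorphisms
  have hU : ∀ i : ι, rootSubgroup G T (charOfWeight eX (P.root i)) =
      ((h.rootSL2 i).comp unipotentUpperSL2).range.map G.subtype := by
    intro i
    obtain ⟨α, hα, hαi⟩ := h.exists_root_eq i
    have key := rootSubgroup_unique_holds hG hTm hα (u := (h.rootSL2 i).comp unipotentUpperSL2)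
      (by rw [hαi]; exact h.isRootHom_rootSL2_upper i)
    rw [hαi] at key
    exact key.symm
  have hV : ∀ i : ι, rootSubgroup G T (charOfWeight eX (P.root i))⁻¹ =
      ((h.rootSL2 i).comp unipotentLowerSL2).range.map G.subtype := by
    intro i
    obtain ⟨α, hα, hαi⟩ := h.exists_root_eq (P.reflectionPerm i i)
    rw [RootPairing.root_reflectionPerm, RootPairing.reflection_apply_self, charOfWeight_neg] at hαi
    have key := rootSubgroup_unique_holds hG hTm hα (u := (h.rootSL2 i).comp unipotentLowerSL2)
      (by rw [hαi]; exact h.isRootHom_rootSL2_lower i)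
    rw [hαi] at key
    exact key.symm
  conv_rhs => rw [← hgen]
  congr 1
  refine le_antisymm (iSup_le fun i => ?_) (iSup₂_le fun i hi => ?_)
  · rw [← hU, ← hV]
    exact le_iSup₂_of_le (f := fun (j : ι) (_ : j ∈ b.support) =>
      rootSubgroup G T (charOfWeight eX (P.root j)) ⊔ rootSubgroup G T (charOfWeight eX (P.root j))⁻¹)
      (i : ι) i.2 le_rfl
  · rw [hU, hV]
    exact le_iSup (fun j : ↥(b.support : Set ι) => ((h.rootSL2 j).comp unipotentUpperSL2).range.map G.subtype ⊔
      ((h.rootSL2 j).comp unipotentLowerSL2).range.map G.subtype) ⟨i, hi⟩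

include hG' hTm' in
/-- The same for `G'`. [cite: SpringerLAG1998, 8.1.1 and 8.2.10] -/
theorem torus_sup_ranges_eq_top' :
    T' ⊔ ⨆ i : ↥(b.support : Set ι), (((h'.rootSL2 i).comp unipotentUpperSL2).range.map G'.subtype ⊔
      ((h'.rootSL2 i).comp unipotentLowerSL2).range.map G'.subtype) = G' :=
  torus_sup_ranges_eq_top h' b hG' hTm'

include hG in
/-- **The first projection `H → G` is onto.** [cite: SpringerLAG1998, 9.6.2] -/
theorem graphFst_surjective : Function.Surjective (graphFst h h' b hTm hTm') := by
  intro g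
  have hg : (g : GL n k) ∈ T ⊔ ⨆ i : ↥(b.support : Set ι), (((h.rootSL2 i).comp unipotentUpperSL2).range.map G.subtype ⊔
      ((h.rootSL2 i).comp unipotentLowerSL2).range.map G.subtype) := by
    rw [torus_sup_ranges_eq_top h b hG hTm]; exact g.2
  obtain ⟨x, hxH, hx⟩ := exists_mem_graphGroup_fstBlockGL_eq h h' hTm.2.1 hTm'.2.1 _ hg
  refine ⟨⟨x, hxH⟩, Subtype.ext ?_⟩
  rw [← hx]
  rfl

include hG' in
/-- **The second projection `H → G'` is onto.** [cite: SpringerLAG1998, 9.6.2] -/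
theorem graphSnd_surjective : Function.Surjective (graphSnd h h' b hTm hTm') := by
  intro g'
  have hg : (g' : GL n' k) ∈ T' ⊔ ⨆ i : ↥(b.support : Set ι), (((h'.rootSL2 i).comp unipotentUpperSL2).range.map G'.subtype ⊔
      ((h'.rootSL2 i).comp unipotentLowerSL2).range.map G'.subtype) := by
    rw [torus_sup_ranges_eq_top' h' b hG' hTm']; exact g'.2
  obtain ⟨x, hxH, hx⟩ := (mem_sndOfGraphGroup_iff h h' hTm.2.1 hTm'.2.1 _).1 (sup_le_sndOfGraphGroup h h' hTm.2.1 hTm'.2.1 _ hg)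
  refine ⟨⟨x, hxH⟩, Subtype.ext ?_⟩
  rw [← hx]
  rfl

/-- **The isomorphism `f = pr₂ ∘ (pr₁|_H)⁻¹ : G ≃* G'` whose graph is `H`.** [cite: SpringerLAG1998, 9.6.2] -/
def graphIso (hG : IsConnectedReductive G) (hG' : IsConnectedReductive G') : ↥G ≃* ↥G' :=
  (MulEquiv.ofBijective (graphFst h h' b hTm hTm')
      ⟨graphFst_injective h h' b hG hTm hG' hTm', graphFst_surjective h h' b hG hTm hTm'⟩).symm.trans
    (MulEquiv.ofBijective (graphSnd h h' b hTm hTm')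
      ⟨graphSnd_injective h h' b hG hTm hG' hTm', graphSnd_surjective h h' b hTm hG' hTm'⟩)

/-- `f (pr₁ x) = pr₂ x` for `x ∈ H`. [folklore] -/
lemma graphIso_graphFst (x : ↥(graphGroup h h' hTm.2.1 hTm'.2.1 (b.support : Set ι))) :
    graphIso h h' b hTm hTm' hG hG' (graphFst h h' b hTm hTm' x) = graphSnd h h' b hTm hTm' x := by
  unfold graphIso
  rw [MulEquiv.trans_apply]
  have e : (MulEquiv.ofBijective (graphFst h h' b hTm hTm')
      ⟨graphFst_injective h h' b hG hTm hG' hTm', graphFst_surjective h h' b hG hTm hTm'⟩).symm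
      (graphFst h h' b hTm hTm' x) = x := by
    apply (MulEquiv.ofBijective (graphFst h h' b hTm hTm') _).injective
    rw [MulEquiv.apply_symm_apply]
    rfl
  rw [e]
  rfl

/-- **The graph of `f` is `H`**: `diag(g, f g) ∈ H`, and `diag(g, g') ∈ H` forces `g' = f g`. [folklore] -/
lemma graphIso_eq_of_mem {g : GL n k} {g' : GL n' k} (hg : g ∈ G)
    (hx : blockDiagGL (g, g') ∈ graphGroup h h' hTm.2.1 hTm'.2.1 (b.support : Set ι)) :
    ((graphIso h h' b hTm hTm' hG hG' ⟨g, hg⟩ : ↥G') : GL n' k) = g' := by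
  have e := graphFst_mk h h' b hTm hTm' hx
  have hfst : graphFst h h' b hTm hTm' ⟨blockDiagGL (g, g'), hx⟩ = ⟨g, hg⟩ := Subtype.ext e.1
  rw [← hfst, graphIso_graphFst, e.2]

/-- `f t = f_T t` on `T`. [cite: SpringerLAG1998, 9.6.2] -/
lemma graphIso_torus (t : ↥T) :
    ((graphIso h h' b hTm hTm' hG hG' (Subgroup.inclusion h.le t) : ↥G') : GL n' k) =
      ((torusIsoOfWeights eX eX' hTm.2.1 hTm'.2.1 t : ↥T') : GL n' k) :=
  graphIso_eq_of_mem h h' b hG hTm hG' hTm' (h.le t.2) (graphTorusHom_mem_graphGroup h h' hTm.2.1 hTm'.2.1 _ t)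

omit [IsAlgClosed k] in
/-- `exp (x (c A)) = exp ((x c) A)`. [folklore] -/
lemma expHom_smul {m : Type*} [Fintype m] [DecidableEq m] {A : Matrix m m k} (hA : IsNilpotent A) (c : k) (x : k) :
    expHom (c • A) (hA.smul c) (Multiplicative.ofAdd x) = expHom A hA (Multiplicative.ofAdd (c * x)) := by
  apply Units.ext
  rw [coe_expHom_apply, coe_expHom_apply, toAdd_ofAdd, toAdd_ofAdd, smul_smul, mul_comm]

include hG hG' in
/-- **`f` carries `u_α` to a rescaled `u'_α`**: for every root `α_j` there is `c ≠ 0` with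
`f (u_j(x)) = u'_j(c x)` — the line `Lie(H)_{α_j} = k · diag(e_j, c e'_j)` (`isRootLine_root`) exponentiates
into `H` (`expHom_mem_of_mem_lieAlgebraGL`) to `diag(u_j(x), u'_j(c x))`. [cite: SpringerLAG1998, 9.6.2] -/
theorem exists_graphIso_rootHom_eq (j : ι) : ∃ c : kˣ, ∀ x : k,
    graphIso h h' b hTm hTm' hG hG' ((h.rootSL2 j).comp unipotentUpperSL2 (Multiplicative.ofAdd x)) =
      (h'.rootSL2 j).comp unipotentUpperSL2 (Multiplicative.ofAdd ((c : k) * x)) := by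
  set H := graphGroup h h' hTm.2.1 hTm'.2.1 (b.support : Set ι) with hH
  obtain ⟨D, hD𝔡, hDw, hD₁, hD₂, -⟩ := isRootLine_root h h' b hG hTm hG' hTm' j
  have hDH : D ∈ lieAlgebraGL H := graphLieGen_le h h' _ _ _ hD𝔡
  obtain ⟨a, a', hDe⟩ := mem_lieAlgebraGL_graphGroup_weight_root eX eX' h h' hG hTm hG' hTm' hDH hDw
  have ha : a ≠ 0 := by
    rintro rfl; apply hD₁; rw [hDe, toBlocks_fromBlocks₁₁, zero_smul]
  have ha' : a' ≠ 0 := by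
    rintro rfl; apply hD₂; rw [hDe, toBlocks_fromBlocks₂₂, zero_smul]
  set c : k := a⁻¹ * a' with hc
  have hc0 : c ≠ 0 := mul_ne_zero (inv_ne_zero ha) ha'
  -- the normalised line element `diag(e_j, c e'_j) ∈ Lie(H)`
  have hD' : fromBlocks (h.rootE j) 0 0 (c • h'.rootE j) ∈ lieAlgebraGL H := by
    have := Submodule.smul_mem _ a⁻¹ hDH
    rw [hDe, fromBlocks_smul, smul_zero, smul_zero, smul_smul, smul_smul, inv_mul_cancel₀ ha, one_smul] at this
    exact this
  have hne : IsNilpotent (h.rootE j) := h.isNilpotent_rootE hTm.2.1 j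
  have hne' : IsNilpotent (h'.rootE j) := h'.isNilpotent_rootE hTm'.2.1 j
  have hnil : IsNilpotent (fromBlocks (h.rootE j) 0 0 (c • h'.rootE j)) :=
    isNilpotent_fromBlocks_zero hne (hne'.smul c)
  refine ⟨Units.mk0 c hc0, fun x => ?_⟩
  have hmem := expHom_mem_of_mem_lieAlgebraGL (isAlgebraicSubgroup_graphGroup h h' _ _ _) hD' hnil (Multiplicative.ofAdd x)
  rw [expHom_fromBlocks hne (hne'.smul c), expHom_smul hne' c x, ← h.coe_rootSL2_upper hG.1.1 hTm.2.1 j x,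
    ← h'.coe_rootSL2_upper hG'.1.1 hTm'.2.1 j (c * x)] at hmem
  apply Subtype.ext
  rw [Units.val_mk0]
  exact graphIso_eq_of_mem h h' b hG hTm hG' hTm' _ hmem

include hG hG' in
/-- **`f` induces the identity of the root datum.** [cite: SpringerLAG1998, 9.6.2] -/
theorem inducesRootDatumId_graphIso : ∀ g : ↥G,
    (((graphIso h h' b hTm hTm' hG hG' g : ↥G') : GL n' k) ∈ T' ↔ (g : GL n k) ∈ T) := by
  intro g
  constructor
  · intro hg'
    -- `diag(g, f g) ∈ H` and `diag(f_T⁻¹ (f g), f g) ∈ H`; the second projection is injective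
    set t' : ↥T' := ⟨_, hg'⟩ with ht'
    set t : ↥T := (torusIsoOfWeights eX eX' hTm.2.1 hTm'.2.1).symm t' with ht
    have e1 : ((graphIso h h' b hTm hTm' hG hG' (Subgroup.inclusion h.le t) : ↥G') : GL n' k) =
        ((graphIso h h' b hTm hTm' hG hG' g : ↥G') : GL n' k) := by
      rw [graphIso_torus, ht, MulEquiv.apply_symm_apply]
    have e2 : Subgroup.inclusion h.le t = g :=
      (graphIso h h' b hTm hTm' hG hG').injective (Subtype.ext e1)
    rw [← e2]
    exact t.2
  · intro hg
    rw [show g = Subgroup.inclusion h.le ⟨g, hg⟩ from rfl, graphIso_torus]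
    exact (torusIsoOfWeights eX eX' hTm.2.1 hTm'.2.1 ⟨g, hg⟩).2

end GraphIso

/-! ### The discharge -/

variable {k : Type*} [Field k]
variable {ι X Y : Type*} [AddCommGroup X] [AddCommGroup Y]
variable {N N' : ℕ} {G T : Subgroup (GL (Fin N) k)} {G' T' : Subgroup (GL (Fin N') k)}
  [IsMulCommutative ↥T] [IsMulCommutative ↥T']

/-- **Springer 9.6.2, first step, discharged: the named fact `chevalley_isomorphism_abstract` holds.**
Over an algebraically closed field of characteristic `0`, two connected reductive groups
`G ≤ GL_N`, `G' ≤ GL_{N'}` with maximal tori `T`, `T'` realising the same root datum `P` are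
isomorphic as abstract groups by an isomorphism inducing the identity of `P`: the graph group
`H ≤ G × G'` (generated by the graph of `f_T : T ≃ T'` and the diagonal root homomorphisms of the
simple roots of a base of `P` — bases exist, `RootPairing.nonempty_base_int`, `P` being reduced,
`isReduced_of_isRootDatumOf_holds`, with finitely many roots, `IsRootDatumOf.finite_index`) is the
graph of such an isomorphism (`graphIso`, `inducesRootDatumId_graphIso`,
`exists_graphIso_rootHom_eq`, `graphIso_torus`). [cite: SpringerLAG1998, Theorem 9.6.2] -/
theorem chevalley_isomorphism_abstract_holds :
    chevalley_isomorphism_abstract (k := k) (ι := ι) (X := X) (Y := Y) (G := G) (T := T) (G' := G') (T' := T') := by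
  intro _ _ hG hT hG' hT' P eX eY eX' eY' h h'
  haveI : Finite ι := h.finite_index hG hT
  haveI : P.IsReduced := isReduced_of_isRootDatumOf_holds hG hT h
  obtain ⟨b⟩ := RootPairing.nonempty_base_int P
  refine ⟨graphIso h h' b hT hT' hG hG', ⟨inducesRootDatumId_graphIso h h' b hG hT hG' hT', fun x t ht => ?_, fun i => ?_⟩⟩
  · have e : (⟨((graphIso h h' b hT hT' hG hG' t : ↥G') : GL (Fin N') k),
        (inducesRootDatumId_graphIso h h' b hG hT hG' hT' t).mpr ht⟩ : ↥T') =
        torusIsoOfWeights eX eX' hT.2.1 hT'.2.1 ⟨(t : GL (Fin N) k), ht⟩ :=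
      Subtype.ext (graphIso_torus h h' b hG hT hG' hT' ⟨(t : GL (Fin N) k), ht⟩)
    rw [e, charOfWeight_torusIsoOfWeights]
  · obtain ⟨c, hc⟩ := exists_graphIso_rootHom_eq h h' b hG hT hG' hT' i
    refine ⟨(h.rootSL2 i).comp unipotentUpperSL2,
      ((h'.rootSL2 i).comp unipotentUpperSL2).comp
        (AddMonoidHom.toMultiplicative (DistribSMul.toAddMonoidHom k (c : k))),
      h.isRootHom_rootSL2_upper i, (h'.isRootHom_rootSL2_upper i).comp_mulLeft c, fun x => ?_⟩
    rw [show x = Multiplicative.ofAdd x.toAdd from rfl, hc]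
    rfl

end Literature.NumberTheory.Automorphic

end
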